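import Literature.Analysis.FunctionSpaces.WightmanFunctionsProofs
import Mathlib.Analysis.InnerProductSpace.Completion
import Mathlib.Analysis.InnerProductSpace.Adjoint
import Mathlib.Analysis.Normed.Module.Completion
import Mathlib.Analysis.Normed.Operator.Extend
import HarnessLib

/-!
# The GNS (Wightman reconstruction) Hilbert space of a Wightman family

Streater–Wightman (1964), §3-4, proof of Thm. 3-7 (pp. 118–125): from a family of tempered
distributions `𝒲ₙ^{(k)}` with the properties (a)–(f) one constructs a Hilbert space as the
completion of the space of finite sequences of test functions modulo the null space of the
positive form (e); the fields act by tensoring on the left, the Poincaré group by (a).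

This file carries out the *algebraic* part of the construction on the free `ℂ`-module spanned
by **words** `l = [(k₁,f₁),…,(kₙ,fₙ)]` (lists of labelled one-point test functions, standing for
the tensor monomials `f₁ ⊗ ⋯ ⊗ fₙ`):

* `WightmanFamily.eval 𝒲 l = 𝒲ₙ^{(k)}(f₁ ⊗ ⋯ ⊗ fₙ)` and the sesquilinear form
  `⟪δ_l, δ_{l'}⟫ = 𝒲(l† ++ l')`, `l† = [(kₙ,f̄ₙ),…,(k₁,f̄₁)]` (`WightmanData.starList`);
* positivity of the form from (e) and hermitian symmetry from (c), packaged as a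
  `PreInnerProductSpace.Core` on the type synonym `GNSSpace 𝒲 h𝒲` (so that Mathlib's
  `InnerProductSpace.ofCore` / `UniformSpace.Completion` produce the Hilbert space
  `GNSHilbert 𝒲 h𝒲`, separated and complete);
* the creation operators `δ_l ↦ δ_{(k,f) :: l}`, their adjoint identity (from the definition
  of `l†`), and the Poincaré action on words (isometric by (a)).

The operator-level consequences (fields on the dense domain, unitary representation, the
Wightman axioms W1–W4 in algebraic form) follow in the second half of the file. Continuity
(strong continuity W0, temperedness W1) is in `WightmanGNSContinuity`, uniqueness of the vacuum
(from (f), `d ≥ 1`) in `WightmanGNSVacuum`, the assembly into `WightmanData`/`IsWightmanQFT` in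
`WightmanGNSReconstruction`, and the spectral condition (from (b)) in `WightmanGNSSpectral`.

## References
* R. F. Streater, A. S. Wightman, PCT, Spin and Statistics, and All That (1964), §3-4,
  Thm. 3-7.
* A. S. Wightman, Quantum field theory in terms of vacuum expectation values, Phys. Rev. 101
  (1956) 860.
-/

noncomputable section

open Filter Topology ComplexConjugate
open scoped InnerProductSpace SchwartzMap ComplexOrder
open Literature.MathematicalPhysics.QuantumLattice

namespace Literature.Analysis.FunctionSpaces

variable {d : ℕ} {κ : Type*}

/-! ## Words and their evaluation -/

namespace WightmanFamily

/-- A **word**: a list `[(k₁,f₁),…,(kₙ,fₙ)]` of labelled one-point test functions, standing for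
the labelled tensor monomial `f₁ ⊗ ⋯ ⊗ fₙ` (Streater–Wightman (1964), §3-4, the sequences
`f = (f₀, f₁, …)` of the reconstruction, restricted to tensor products). [cite: StreaterWightman1964, §3-4] -/
abbrev Word (d : ℕ) (κ : Type*) : Type _ := List (κ × 𝓢(SpaceTime d, ℂ))

variable (𝒲 : WightmanFamily d κ)

/-- The labels of a word. [folklore] -/
def wordLab (l : Word d κ) : Fin l.length → κ := fun i => (l.get i).1

/-- The one-point test functions of a word. [folklore] -/
def wordFn (l : Word d κ) : Fin l.length → 𝓢(SpaceTime d, ℂ) := fun i => (l.get i).2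

/-- The tensor monomial `f₁ ⊗ ⋯ ⊗ fₙ` of a word (`SchwartzMap.tensorFin`). [folklore] -/
def wordTensor (l : Word d κ) : 𝓢((Fin l.length → SpaceTime d), ℂ) :=
  SchwartzMap.tensorFin l.length (wordFn l)

/-- Unfolding of `wordLab`. [folklore] -/
@[simp] theorem wordLab_apply (l : Word d κ) (i : Fin l.length) : wordLab l i = (l.get i).1 := rfl

/-- Unfolding of `wordFn`. [folklore] -/
@[simp] theorem wordFn_apply (l : Word d κ) (i : Fin l.length) : wordFn l i = (l.get i).2 := rfl

/-- The tensor monomial of a word is the product of its letters. [folklore] -/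
@[simp] theorem wordTensor_apply (l : Word d κ) (x : Fin l.length → SpaceTime d) :
    wordTensor l x = ∏ i, (l.get i).2 (x i) := by
  simp [wordTensor]

/-- **Evaluation of a Wightman family on a word**: `𝒲(l) = 𝒲ₙ^{(k₁,…,kₙ)}(f₁ ⊗ ⋯ ⊗ fₙ)` for
`l = [(k₁,f₁),…,(kₙ,fₙ)]` (Streater–Wightman (1964), §3-3 eq. (3-21)). [cite: StreaterWightman1964, §3-3 eq. (3-21)] -/
def eval (l : Word d κ) : ℂ := 𝒲 l.length (wordLab l) (wordTensor l)

/-- Transport of `𝒲ₘ^{(k)}(F)` along an equality of arities `m = m'`. [folklore] -/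
theorem apply_congr {m m' : ℕ} (h : m = m') {k : Fin m → κ} {k' : Fin m' → κ}
    {F : 𝓢((Fin m → SpaceTime d), ℂ)} {F' : 𝓢((Fin m' → SpaceTime d), ℂ)}
    (hk : ∀ i, k' (Fin.cast h i) = k i) (hF : ∀ x, F' x = F (fun i => x (Fin.cast h i))) :
    𝒲 m' k' F' = 𝒲 m k F := by
  subst h
  have hk' : k' = k := funext hk
  have hF' : F' = F := by ext x; exact hF x
  rw [hk', hF']

/-- `𝒲` evaluated on a tensor witness of the word's test functions is `𝒲(l)`. [folklore] -/
theorem apply_eq_eval_of_isTensorOf (l : Word d κ) {F : 𝓢((Fin l.length → SpaceTime d), ℂ)}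
    (hF : IsTensorOf F (wordFn l)) : 𝒲 l.length (wordLab l) F = eval 𝒲 l := by
  rw [eval, hF.unique (isTensorOf_tensorFin _)]
  rfl

/-- Reindexing a product over `Fin m'` along `m = m'`. [folklore] -/
theorem prod_fin_cast {M : Type*} [CommMonoid M] {m m' : ℕ} (h : m = m') (g : Fin m' → M) :
    ∏ j, g j = ∏ i : Fin m, g (Fin.cast h i) := by
  subst h; rfl

/-- Evaluation on a word presented by `List.ofFn`. [folklore] -/
theorem eval_ofFn {n : ℕ} (k : Fin n → κ) (f : Fin n → 𝓢(SpaceTime d, ℂ))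
    {F : 𝓢((Fin n → SpaceTime d), ℂ)} (hF : IsTensorOf F f) :
    eval 𝒲 (List.ofFn fun i => (k i, f i)) = 𝒲 n k F := by
  unfold eval
  refine apply_congr 𝒲 (List.length_ofFn).symm (fun i => ?_) (fun x => ?_)
  · simp [wordLab]
  · rw [hF, wordTensor_apply, prod_fin_cast (List.length_ofFn).symm]
    refine Finset.prod_congr rfl fun i _ => ?_
    simp

/-! ### The adjoint word and the pairing -/

/-- `l†` has the same length as `l`. [folklore] -/
@[simp] theorem length_starList (l : Word d κ) : (WightmanData.starList l).length = l.length := by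
  simp [WightmanData.starList]

/-- Entries of `l†`: `(l†)ⱼ = (k_{n-1-j}, f̄_{n-1-j})`. [folklore] -/
theorem getElem_starList (l : Word d κ) (j : ℕ) (hj : j < (WightmanData.starList l).length) :
    (WightmanData.starList l)[j] =
      ((l[l.length - 1 - j]'(by simp at hj; omega)).1,
        starTest (l[l.length - 1 - j]'(by simp at hj; omega)).2) := by
  simp [WightmanData.starList, List.getElem_reverse]

/-- Entries of `l†` in `Fin` indexing: entry `rev j` of `l`, conjugated. [folklore] -/
theorem get_starList (l : Word d κ) (j : Fin (WightmanData.starList l).length) :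
    (WightmanData.starList l).get j =
      ((l.get (Fin.rev (Fin.cast (length_starList l) j))).1,
        starTest (l.get (Fin.rev (Fin.cast (length_starList l) j))).2) := by
  rw [List.get_eq_getElem, getElem_starList]
  have h2 : l[l.length - 1 - (j : ℕ)]'(by have := j.2; simp at this; omega) =
      l.get (Fin.rev (Fin.cast (length_starList l) j)) := by
    simp only [List.get_eq_getElem, Fin.val_rev, Fin.val_cast]
    congr 1
    omega
  rw [h2]

/-- `l†† = l`. [folklore] -/
@[simp] theorem starList_starList (l : Word d κ) :
    WightmanData.starList (WightmanData.starList l) = l := by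
  simp [WightmanData.starList, List.map_reverse, Function.comp_def, starTest_starTest]

/-- `(l ++ l')† = l'† ++ l†`. [folklore] -/
@[simp] theorem starList_append (l l' : Word d κ) :
    WightmanData.starList (l ++ l') = WightmanData.starList l' ++ WightmanData.starList l := by
  simp [WightmanData.starList]

/-- Entries of a concatenation, left block. [folklore] -/
theorem get_append_castAdd (l l' : Word d κ) {m : ℕ} (h : l.length + m = (l ++ l').length)
    (i : Fin l.length) : (l ++ l').get (Fin.cast h (Fin.castAdd m i)) = l.get i := by
  simp [List.getElem_append_left]

/-- Entries of a concatenation, right block. [folklore] -/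
theorem get_append_natAdd (l l' : Word d κ) {m : ℕ} (h : l.length + m = (l ++ l').length)
    (j : Fin m) : (l ++ l').get (Fin.cast h (Fin.natAdd l.length j)) =
      l'.get ⟨j, by have := j.2; simp at h; omega⟩ := by
  simp [List.getElem_append_right]

/-- The **pairing** of two words, `⟪l, l'⟫ = 𝒲(l† ++ l')`, i.e.
`𝒲_{n+m}^{(kₙ,…,k₁,k'₁,…,k'ₘ)}(f̄ₙ ⊗ ⋯ ⊗ f̄₁ ⊗ f'₁ ⊗ ⋯ ⊗ f'ₘ)` (Streater–Wightman (1964), §3-4,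
eq. (3-48): the scalar product `(f, g) = ∑ 𝒲_{j+k}(f_j* × g_k)`). [cite: StreaterWightman1964, §3-4 eq. (3-48)] -/
def pairing (l l' : Word d κ) : ℂ := eval 𝒲 (WightmanData.starList l ++ l')

/-- The pairing in the `Fin.append` form used by the positivity property (e)
(`IsPositiveDefiniteFamily`) and by hermiticity (c). [folklore] -/
theorem pairing_eq_apply_append (l l' : Word d κ)
    {G : 𝓢((Fin (l.length + l'.length) → SpaceTime d), ℂ)}
    (hG : IsAppendTensorOf G (starTest (permTest Fin.revPerm (wordTensor l))) (wordTensor l')) :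
    pairing 𝒲 l l' =
      𝒲 (l.length + l'.length) (Fin.append (wordLab l ∘ Fin.rev) (wordLab l')) G := by
  unfold pairing eval
  have hlen : l.length + l'.length = (WightmanData.starList l ++ l').length := by simp
  have hlen₁ : (WightmanData.starList l).length + l'.length =
      (WightmanData.starList l ++ l').length := by simp
  -- the entries of `l† ++ l'` in `Fin.append` indexing
  have hget : ∀ i : Fin (l.length + l'.length),
      (WightmanData.starList l ++ l').get (Fin.cast hlen i) =
        Fin.append (fun j => ((l.get (Fin.rev j)).1, starTest (l.get (Fin.rev j)).2))
          (fun j => l'.get j) i := by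
    intro i
    refine Fin.addCases (fun j => ?_) (fun j => ?_) i
    · rw [Fin.append_left, List.get_eq_getElem]
      have hj : (Fin.cast hlen (Fin.castAdd l'.length j) : ℕ) <
          (WightmanData.starList l).length := by simp
      rw [List.getElem_append_left hj]
      simp only [Fin.val_cast, Fin.val_castAdd, getElem_starList]
      have h2 : l[l.length - 1 - (j : ℕ)]'(by omega) = l.get (Fin.rev j) := by
        simp only [List.get_eq_getElem, Fin.val_rev]
        congr 1
        omega
      rw [h2]
    · rw [Fin.append_right, List.get_eq_getElem]
      have hj : (WightmanData.starList l).length ≤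
          (Fin.cast hlen (Fin.natAdd l.length j) : ℕ) := by simp
      rw [List.getElem_append_right hj]
      simp only [List.get_eq_getElem, Fin.val_cast, Fin.val_natAdd]
      congr 1
      simp
  refine apply_congr 𝒲 hlen (fun i => ?_) (fun x => ?_)
  · rw [wordLab_apply, hget]
    refine Fin.addCases (fun j => ?_) (fun j => ?_) i <;> simp
  · rw [hG, wordTensor_apply, starTest_apply, permTest_apply, wordTensor_apply, wordTensor_apply,
      map_prod, prod_fin_cast hlen, Fin.prod_univ_add]
    simp only [hget, Fin.append_left, Fin.append_right, Function.comp_apply, Fin.revPerm_apply,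
      starTest_apply]
    congr 1
    exact Fintype.prod_equiv Fin.revPerm _ _ fun j => by simp

/-- The adjoint word evaluates to the conjugate, given hermiticity (c):
`𝒲(l†) = conj 𝒲(l)` (Streater–Wightman (1964), §3-3 eq. (3-33)). [cite: StreaterWightman1964, §3-3 eq. (3-33)] -/
theorem eval_starList (hc : IsHermitianFamily 𝒲) (l : Word d κ) :
    eval 𝒲 (WightmanData.starList l) = conj (eval 𝒲 l) := by
  rw [eval, eval, ← hc l.length (wordLab l) (wordTensor l)]
  have hlen : l.length = (WightmanData.starList l).length := (length_starList l).symm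
  refine apply_congr 𝒲 hlen (fun i => ?_) (fun x => ?_)
  · rw [wordLab_apply, get_starList]
    simp
  · rw [wordTensor_apply, starTest_apply, permTest_apply, wordTensor_apply, map_prod,
      prod_fin_cast hlen]
    simp only [get_starList, starTest_apply, Function.comp_apply, Fin.revPerm_apply,
      Fin.cast_cast]
    exact Fintype.prod_equiv Fin.revPerm _ _ fun j => by simp

/-- **Hermitian symmetry of the pairing** from (c): `conj ⟪l', l⟫ = ⟪l, l'⟫`. [folklore] -/
theorem conj_pairing (hc : IsHermitianFamily 𝒲) (l l' : Word d κ) :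
    conj (pairing 𝒲 l' l) = pairing 𝒲 l l' := by
  rw [pairing, pairing, ← eval_starList 𝒲 hc, starList_append, starList_starList]

/-- **The adjoint identity** `⟪(k,f) :: l, l'⟫ = ⟪l, (k,f̄) :: l'⟫`: creation by `f` on the left
is adjoint to creation by `f̄` (Streater–Wightman (1964), §3-4, hermiticity of the
reconstructed field, eq. (3-52)). [cite: StreaterWightman1964, §3-4 eq. (3-52)] -/
theorem pairing_cons_left (p : κ × 𝓢(SpaceTime d, ℂ)) (l l' : Word d κ) :
    pairing 𝒲 (p :: l) l' = pairing 𝒲 l ((p.1, starTest p.2) :: l') := by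
  simp [pairing, WightmanData.starList_cons, List.append_assoc]

/-! ### Invariance of evaluation under the Poincaré action (a) -/

/-- `(1 : E ≃L E)⁻¹ x = x`. [folklore] -/
@[simp] theorem _root_.Literature.Analysis.FunctionSpaces.continuousLinearEquiv_one_symm_apply (x : SpaceTime d) :
    (1 : SpaceTime d ≃L[ℝ] SpaceTime d).symm x = x := rfl

/-- The Poincaré group acting letterwise on a word: `(k, f) ↦ (k, g • f)`. [folklore] -/
def actLetter (g : PoincareGroup d) (p : κ × 𝓢(SpaceTime d, ℂ)) : κ × 𝓢(SpaceTime d, ℂ) :=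
  (p.1, poincareTest g p.2)

/-- The action does not change labels. [folklore] -/
@[simp] theorem actLetter_fst (g : PoincareGroup d) (p : κ × 𝓢(SpaceTime d, ℂ)) :
    (actLetter g p).1 = p.1 := rfl

/-- The action on the test function of a letter. [folklore] -/
@[simp] theorem actLetter_snd (g : PoincareGroup d) (p : κ × 𝓢(SpaceTime d, ℂ)) :
    (actLetter g p).2 = poincareTest g p.2 := rfl

/-- The letterwise action is a left action. [folklore] -/
theorem actLetter_mul (g g' : PoincareGroup d) (p : κ × 𝓢(SpaceTime d, ℂ)) :
    actLetter (g * g') p = actLetter g (actLetter g' p) := by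
  simp [actLetter, poincareTest_mul]

/-- The identity acts trivially on letters. [folklore] -/
@[simp] theorem actLetter_one (p : κ × 𝓢(SpaceTime d, ℂ)) :
    actLetter (1 : PoincareGroup d) p = p := by
  rcases p with ⟨k, f⟩
  simp only [actLetter, Prod.mk.injEq, true_and]
  ext x
  simp [poincareTest_apply]

/-- Conjugation commutes with the Poincaré action on test functions. [folklore] -/
theorem starTest_poincareTest (g : PoincareGroup d) (f : 𝓢(SpaceTime d, ℂ)) :
    starTest (poincareTest g f) = poincareTest g (starTest f) := by
  ext x
  simp [starTest_apply, poincareTest_apply]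

/-- `(g • l)† = g • l†`. [folklore] -/
theorem starList_map_actLetter (g : PoincareGroup d) (l : Word d κ) :
    WightmanData.starList (l.map (actLetter g)) = (WightmanData.starList l).map (actLetter g) := by
  simp [WightmanData.starList, List.map_reverse, Function.comp_def, actLetter,
    starTest_poincareTest]

/-- **Invariance of evaluation** from (a): `𝒲(g • l) = 𝒲(l)`, since the tensor monomial of
`g • l` is `g • (f₁ ⊗ ⋯ ⊗ fₙ)` (`poincareTestMulti`) (Streater–Wightman (1964), §3-3,
eq. (3-26)). [cite: StreaterWightman1964, §3-3 eq. (3-26)] -/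
theorem eval_map_actLetter (ha : IsPoincareInvariantFamily 𝒲) (g : PoincareGroup d)
    (l : Word d κ) : eval 𝒲 (l.map (actLetter g)) = eval 𝒲 l := by
  rw [eval, eval, ← ha g l.length (wordLab l) (wordTensor l)]
  have hlen : l.length = (l.map (actLetter g)).length := (List.length_map _).symm
  refine apply_congr 𝒲 hlen (fun i => ?_) (fun x => ?_)
  · simp [wordLab]
  · rw [wordTensor_apply, poincareTestMulti_apply, wordTensor_apply, prod_fin_cast hlen]
    refine Finset.prod_congr rfl fun i _ => ?_
    simp [poincareTest_apply]

/-- **Invariance of the pairing** from (a): `⟪g • l, g • l'⟫ = ⟪l, l'⟫`. [folklore] -/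
theorem pairing_map_actLetter (ha : IsPoincareInvariantFamily 𝒲) (g : PoincareGroup d)
    (l l' : Word d κ) :
    pairing 𝒲 (l.map (actLetter g)) (l'.map (actLetter g)) = pairing 𝒲 l l' := by
  rw [pairing, pairing, starList_map_actLetter, ← List.map_append, eval_map_actLetter 𝒲 ha]

/-! ### Local commutativity on words (d) -/

/-- Entries of `l₁ ++ q :: p :: l₂` are those of `l₁ ++ p :: q :: l₂` read through the
transposition of the two middle positions. [folklore] -/
theorem get_append_cons_cons_swap (l₁ l₂ : Word d κ) (p q : κ × 𝓢(SpaceTime d, ℂ))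
    (h : (l₁ ++ p :: q :: l₂).length = (l₁ ++ q :: p :: l₂).length)
    (hj : l₁.length < (l₁ ++ p :: q :: l₂).length)
    (hj' : l₁.length + 1 < (l₁ ++ p :: q :: l₂).length) (i : Fin (l₁ ++ p :: q :: l₂).length) :
    (l₁ ++ q :: p :: l₂).get (Fin.cast h i) =
      (l₁ ++ p :: q :: l₂).get (Equiv.swap ⟨l₁.length, hj⟩ ⟨l₁.length + 1, hj'⟩ i) := by
  rcases i with ⟨i, hi⟩
  simp only [List.get_eq_getElem, Fin.val_cast]
  rcases Nat.lt_trichotomy i l₁.length with hlt | heq | hgt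
  · rw [Equiv.swap_apply_of_ne_of_ne (by simp [Fin.ext_iff]; omega) (by simp [Fin.ext_iff]; omega)]
    simp [List.getElem_append_left hlt]
  · subst heq
    rw [Equiv.swap_apply_left]
    simp [List.getElem_append_right (le_refl _)]
  · rcases Nat.lt_or_ge i (l₁.length + 2) with hlt2 | hge2
    · have hi1 : i = l₁.length + 1 := by omega
      subst hi1
      rw [Equiv.swap_apply_right]
      simp [List.getElem_append_right (Nat.le_succ _)]
    · rw [Equiv.swap_apply_of_ne_of_ne (by simp [Fin.ext_iff]; omega)
        (by simp [Fin.ext_iff]; omega)]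
      obtain ⟨k, rfl⟩ : ∃ k, i = l₁.length + (k + 2) := ⟨i - l₁.length - 2, by omega⟩
      simp [List.getElem_append_right]

/-- **Local commutativity on words** from (d): if the test functions `f`, `g` of two adjacent
letters have spacelike-separated supports, exchanging the letters does not change `𝒲(l)`
(Streater–Wightman (1964), §3-3 eq. (3-34)). [cite: StreaterWightman1964, §3-3 eq. (3-34)] -/
theorem eval_append_cons_cons_comm (hd : IsLocalFamily 𝒲) (l₁ l₂ : Word d κ)
    (p q : κ × 𝓢(SpaceTime d, ℂ))
    (hpq : AreSpacelikeSeparated (tsupport (p.2 : SpaceTime d → ℂ)) (tsupport (q.2 : SpaceTime d → ℂ))) :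
    eval 𝒲 (l₁ ++ p :: q :: l₂) = eval 𝒲 (l₁ ++ q :: p :: l₂) := by
  set l := l₁ ++ p :: q :: l₂ with hl
  have hj : l₁.length < l.length := by simp [hl]
  have hj' : l₁.length + 1 < l.length := by simp [hl]
  set j : Fin l.length := ⟨l₁.length, hj⟩
  have hjv : (j : ℕ) + 1 < l.length := hj'
  have hpj : (wordFn l) j = p.2 := by
    simp [wordFn, j, hl, List.getElem_append_right (le_refl _)]
  have hqj : (wordFn l) ⟨(j : ℕ) + 1, hjv⟩ = q.2 := by
    simp [wordFn, j, hl, List.getElem_append_right (Nat.le_succ _)]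
  have key := hd l.length (wordLab l) (wordFn l) j hjv (wordTensor l)
    (SchwartzMap.tensorFin l.length (wordFn l ∘ Equiv.swap j ⟨(j : ℕ) + 1, hjv⟩))
    (isTensorOf_tensorFin _) (isTensorOf_tensorFin _) (by rwa [hpj, hqj])
  rw [eval, key, eval]
  have hlen : l.length = (l₁ ++ q :: p :: l₂).length := by simp [hl]
  symm
  refine apply_congr 𝒲 hlen (fun i => ?_) (fun x => ?_)
  · simp only [wordLab_apply, Function.comp_apply]
    rw [get_append_cons_cons_swap l₁ l₂ p q hlen hj hj' i]
  · rw [wordTensor_apply, SchwartzMap.tensorFin_apply, prod_fin_cast hlen]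
    refine Finset.prod_congr rfl fun i _ => ?_
    simp only [Function.comp_apply, wordFn_apply]
    rw [get_append_cons_cons_swap l₁ l₂ p q hlen hj hj' i]

/-! ### Cluster property on words (f) -/

/-- **Cluster property on words** from (f): for spacelike `a`,
`𝒲(l ++ (λa) • l') → 𝒲(l) 𝒲(l')` as `λ → ∞`, where `(λa) • l'` translates every test function of
`l'` by `λ a` (Streater–Wightman (1964), §3-3 eq. (3-37)). [cite: StreaterWightman1964, §3-3 eq. (3-37)] -/
theorem tendsto_eval_append_translate (hf : HasClusterProperty 𝒲) (l l' : Word d κ)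
    {a : SpaceTime d} (ha : IsSpacelike a) :
    Tendsto (fun t : ℝ => eval 𝒲 (l ++ l'.map (actLetter
      (SemidirectProduct.inl (Multiplicative.ofAdd (t • a)) : PoincareGroup d))))
      atTop (𝓝 (eval 𝒲 l * eval 𝒲 l')) := by
  set σ : ℝ → (κ × 𝓢(SpaceTime d, ℂ)) → (κ × 𝓢(SpaceTime d, ℂ)) := fun t =>
    actLetter (SemidirectProduct.inl (Multiplicative.ofAdd (t • a)) : PoincareGroup d)
  have hlen : ∀ t, l.length + l'.length = (l ++ l'.map (σ t)).length := fun t => by simp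
  -- the appended tensor witnesses
  have key := hf l.length l'.length (wordLab l) (wordLab l') (wordTensor l) (wordTensor l') a ha
    (fun t => SchwartzMap.appendTensor (wordTensor l) (translateMulti (t • a) (wordTensor l')))
    (fun t => isAppendTensorOf_appendTensor _ _)
  refine (tendsto_congr fun t => ?_).1 key
  rw [eval]
  symm
  refine apply_congr 𝒲 (hlen t) (fun i => ?_) (fun x => ?_)
  · refine Fin.addCases (fun j => ?_) (fun j => ?_) i
    · rw [Fin.append_left, wordLab_apply, wordLab_apply]
      have := get_append_castAdd l (l'.map (σ t)) (hlen t) j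
      rw [this]
    · rw [Fin.append_right, wordLab_apply, wordLab_apply]
      have := get_append_natAdd l (l'.map (σ t)) (hlen t) j
      rw [this]
      simp [σ, actLetter]
  · rw [SchwartzMap.appendTensor_apply, translateMulti_apply, wordTensor_apply, wordTensor_apply,
      wordTensor_apply, prod_fin_cast (hlen t), Fin.prod_univ_add]
    congr 1
    · refine Finset.prod_congr rfl fun j _ => ?_
      rw [get_append_castAdd l (l'.map (σ t)) (hlen t) j]
      rfl
    · refine Finset.prod_congr rfl fun j _ => ?_
      rw [get_append_natAdd l (l'.map (σ t)) (hlen t) j]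
      simp [σ, actLetter, poincareTest_apply]

/-! ### Linearity of evaluation in a single letter -/

/-- A word with a distinguished middle letter, presented in `Fin.append`/`Fin.cons` indexing:
`𝒲(L ++ (k,h) :: L') = 𝒲ₙ^{(lab)}(⊗ (fn h))` with `n = |L| + (|L'| + 1)`. [folklore] -/
theorem eval_append_cons (L L' : Word d κ) (k : κ) (h : 𝓢(SpaceTime d, ℂ)) :
    eval 𝒲 (L ++ (k, h) :: L') =
      𝒲 (L.length + (L'.length + 1))
        (Fin.append (wordLab L) (Fin.cons k (wordLab L')))
        (SchwartzMap.tensorFin _ (Fin.append (wordFn L) (Fin.cons h (wordFn L')))) := by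
  have hlen : L.length + (L'.length + 1) = (L ++ (k, h) :: L').length := by simp
  have hget : ∀ i : Fin (L.length + (L'.length + 1)),
      (L ++ (k, h) :: L').get (Fin.cast hlen i) =
        Fin.append (fun j => L.get j) (Fin.cons (k, h) fun j => L'.get j) i := by
    intro i
    refine Fin.addCases (fun j => ?_) (fun j => ?_) i
    · rw [Fin.append_left, get_append_castAdd]
    · rw [Fin.append_right, get_append_natAdd]
      refine Fin.cases ?_ (fun j' => ?_) j
      · simp
      · simp
  rw [eval]
  refine apply_congr 𝒲 hlen (fun i => ?_) (fun x => ?_)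
  · rw [wordLab_apply, hget]
    refine Fin.addCases (fun j => ?_) (fun j => ?_) i
    · simp
    · refine Fin.cases ?_ (fun j' => ?_) j <;> simp
  · rw [wordTensor_apply, SchwartzMap.tensorFin_apply, prod_fin_cast hlen]
    refine Finset.prod_congr rfl fun i _ => ?_
    rw [hget]
    refine Fin.addCases (fun j => ?_) (fun j => ?_) i
    · simp
    · refine Fin.cases ?_ (fun j' => ?_) j <;> simp

/-- The tensor monomial is additive in a single factor. [folklore] -/
theorem tensorFin_append_cons_add {n m : ℕ} (a : Fin n → 𝓢(SpaceTime d, ℂ))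
    (b : Fin m → 𝓢(SpaceTime d, ℂ)) (f g : 𝓢(SpaceTime d, ℂ)) :
    SchwartzMap.tensorFin (n + (m + 1)) (Fin.append a (Fin.cons (f + g) b)) =
      SchwartzMap.tensorFin _ (Fin.append a (Fin.cons f b)) +
        SchwartzMap.tensorFin _ (Fin.append a (Fin.cons g b)) := by
  ext x
  simp only [SchwartzMap.tensorFin_apply, add_apply, Fin.prod_univ_add,
    Fin.prod_univ_succ, Fin.append_left, Fin.append_right, Fin.cons_zero, Fin.cons_succ]
  ring

/-- The tensor monomial is homogeneous in a single factor. [folklore] -/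
theorem tensorFin_append_cons_smul {n m : ℕ} (a : Fin n → 𝓢(SpaceTime d, ℂ))
    (b : Fin m → 𝓢(SpaceTime d, ℂ)) (c : ℂ) (f : 𝓢(SpaceTime d, ℂ)) :
    SchwartzMap.tensorFin (n + (m + 1)) (Fin.append a (Fin.cons (c • f) b)) =
      c • SchwartzMap.tensorFin _ (Fin.append a (Fin.cons f b)) := by
  ext x
  simp only [SchwartzMap.tensorFin_apply, smul_apply, Fin.prod_univ_add,
    Fin.prod_univ_succ, Fin.append_left, Fin.append_right, Fin.cons_zero, Fin.cons_succ,
    smul_eq_mul]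
  ring

/-- **Evaluation is additive in each letter** (multilinearity of `𝒲ₙ(f₁ ⊗ ⋯ ⊗ fₙ)` in each
`fⱼ`). [folklore] -/
theorem eval_append_cons_add (L L' : Word d κ) (k : κ) (f g : 𝓢(SpaceTime d, ℂ)) :
    eval 𝒲 (L ++ (k, f + g) :: L') = eval 𝒲 (L ++ (k, f) :: L') + eval 𝒲 (L ++ (k, g) :: L') := by
  simp only [eval_append_cons, tensorFin_append_cons_add, map_add]

/-- **Evaluation is homogeneous in each letter**. [folklore] -/
theorem eval_append_cons_smul (L L' : Word d κ) (k : κ) (c : ℂ) (f : 𝓢(SpaceTime d, ℂ)) :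
    eval 𝒲 (L ++ (k, c • f) :: L') = c * eval 𝒲 (L ++ (k, f) :: L') := by
  simp only [eval_append_cons, tensorFin_append_cons_smul, map_smul, smul_eq_mul]

/-! ## The positive form on the free space -/

section Free

/-- The **sesquilinear form** on the free `ℂ`-module over words:
`⟪v, v'⟫ = ∑_{l,l'} conj(v_l) v'_{l'} 𝒲(l† ++ l')` (Streater–Wightman (1964), §3-4,
eq. (3-48)). [cite: StreaterWightman1964, §3-4 eq. (3-48)] -/
def innerFree (v v' : Word d κ →₀ ℂ) : ℂ :=
  conj (Finsupp.linearCombination ℂ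
    (fun l => conj (Finsupp.linearCombination ℂ (pairing 𝒲 l) v')) v)

/-- The form as a double sum over the supports. [folklore] -/
theorem innerFree_eq_sum (v v' : Word d κ →₀ ℂ) :
    innerFree 𝒲 v v' = ∑ l ∈ v.support, ∑ l' ∈ v'.support,
      conj (v l) * v' l' * pairing 𝒲 l l' := by
  simp only [innerFree, Finsupp.linearCombination_apply, Finsupp.sum, smul_eq_mul, map_sum,
    map_mul, Complex.conj_conj, Finset.mul_sum]
  refine Finset.sum_congr rfl fun l _ => Finset.sum_congr rfl fun l' _ => ?_
  ring

/-- The form is additive in the first argument. [folklore] -/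
theorem innerFree_add_left (x y z : Word d κ →₀ ℂ) :
    innerFree 𝒲 (x + y) z = innerFree 𝒲 x z + innerFree 𝒲 y z := by
  simp [innerFree, map_add]

/-- The form is conjugate-homogeneous in the first argument. [folklore] -/
theorem innerFree_smul_left (x y : Word d κ →₀ ℂ) (r : ℂ) :
    innerFree 𝒲 (r • x) y = conj r * innerFree 𝒲 x y := by
  simp [innerFree, map_smul]

/-- The form on basis vectors is the pairing: `⟪δ_l, δ_{l'}⟫ = 𝒲(l† ++ l')`. [folklore] -/
@[simp] theorem innerFree_single_single (l l' : Word d κ) (a b : ℂ) :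
    innerFree 𝒲 (Finsupp.single l a) (Finsupp.single l' b) = conj a * b * pairing 𝒲 l l' := by
  simp only [innerFree, Finsupp.linearCombination_single, smul_eq_mul, map_mul, Complex.conj_conj]
  ring

/-- **Hermitian symmetry** of the form from (c). [folklore] -/
theorem conj_innerFree (hc : IsHermitianFamily 𝒲) (x y : Word d κ →₀ ℂ) :
    conj (innerFree 𝒲 y x) = innerFree 𝒲 x y := by
  rw [innerFree_eq_sum, innerFree_eq_sum, map_sum, Finset.sum_comm]
  refine Finset.sum_congr rfl fun l _ => ?_
  rw [map_sum]
  refine Finset.sum_congr rfl fun l' _ => ?_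
  rw [map_mul, map_mul, Complex.conj_conj, conj_pairing 𝒲 hc]
  ring

/-- The form after relabelling the basis (`Finsupp.mapDomain`). [folklore] -/
theorem innerFree_mapDomain (φ ψ : Word d κ → Word d κ) (v v' : Word d κ →₀ ℂ) :
    innerFree 𝒲 (Finsupp.mapDomain φ v) (Finsupp.mapDomain ψ v') =
      ∑ l ∈ v.support, ∑ l' ∈ v'.support, conj (v l) * v' l' * pairing 𝒲 (φ l) (ψ l') := by
  simp only [innerFree]
  rw [Finsupp.linearCombination_mapDomain, Finsupp.linearCombination_apply, Finsupp.sum,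
    map_sum]
  refine Finset.sum_congr rfl fun l _ => ?_
  simp only [Function.comp_apply, smul_eq_mul, map_mul, Complex.conj_conj]
  rw [Finsupp.linearCombination_mapDomain, Finsupp.linearCombination_apply, Finsupp.sum,
    Finset.mul_sum]
  refine Finset.sum_congr rfl fun l' _ => ?_
  simp only [Function.comp_apply, smul_eq_mul]
  ring

/-- **Positivity of the form** from (e): `0 ≤ ⟪v, v⟫` (as a complex number of the closed
right half-line), i.e. Streater–Wightman (1964), §3-3 eq. (3-35) for the finite sequence of
tensor monomials underlying `v`. [cite: StreaterWightman1964, §3-3 eq. (3-35)] -/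
theorem innerFree_self_nonneg (he : IsPositiveDefiniteFamily 𝒲) (v : Word d κ →₀ ℂ) :
    0 ≤ innerFree 𝒲 v v := by
  classical
  set s := v.support
  set e : Fin s.card ≃ s := s.equivFin.symm
  let deg : Fin s.card → ℕ := fun i => (e i : Word d κ).length
  let lab : (i : Fin s.card) → Fin (deg i) → κ := fun i => wordLab (e i : Word d κ)
  let F : (i : Fin s.card) → 𝓢((Fin (deg i) → SpaceTime d), ℂ) := fun i =>
    v (e i) • wordTensor (e i : Word d κ)
  let G : (i j : Fin s.card) → 𝓢((Fin (deg i + deg j) → SpaceTime d), ℂ) := fun i j =>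
    (conj (v (e i)) * v (e j)) •
      SchwartzMap.appendTensor (starTest (permTest Fin.revPerm (wordTensor (e i : Word d κ))))
        (wordTensor (e j : Word d κ))
  have hG : ∀ i j, IsAppendTensorOf (G i j) (starTest (permTest Fin.revPerm (F i))) (F j) := by
    intro i j x
    simp only [G, F, smul_apply, SchwartzMap.appendTensor_apply, starTest_apply,
      permTest_apply, smul_eq_mul, map_mul]
    ring
  have hpos := he s.card deg lab F G hG
  have hsum : ∑ i, ∑ j, 𝒲 (deg i + deg j) (Fin.append (lab i ∘ Fin.rev) (lab j)) (G i j) =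
      innerFree 𝒲 v v := by
    simp only [G, map_smul, smul_eq_mul]
    rw [innerFree_eq_sum]
    rw [← Finset.sum_coe_sort s, ← e.sum_comp]
    refine Finset.sum_congr rfl fun i _ => ?_
    rw [← Finset.sum_coe_sort s, ← e.sum_comp]
    refine Finset.sum_congr rfl fun j _ => ?_
    rw [← pairing_eq_apply_append 𝒲 _ _ (isAppendTensorOf_appendTensor _ _)]
  rwa [hsum] at hpos

end Free

/-! ## The pre-Hilbert space `GNSSpace` -/

/-- The **GNS pre-Hilbert space** of a Wightman family with the properties (a)–(f): the free
`ℂ`-module over words (finite linear combinations `∑ c_l δ_l` of tensor monomials), to be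
equipped with the positive semidefinite inner product `⟪δ_l, δ_{l'}⟫ = 𝒲(l† ++ l')`
(Streater–Wightman (1964), §3-4, the vector space of sequences `f` with the scalar product
(3-48)). A type synonym, so that the seminormed inner-product structure does not leak to
`Finsupp`. The hypothesis `h𝒲` is a parameter of the type: the inner product is hermitian by
(c) and positive by (e). [cite: StreaterWightman1964, §3-4] -/
@[nolint unusedArguments]
def GNSSpace (𝒲 : WightmanFamily d κ) (_h𝒲 : IsWightmanFamily 𝒲) : Type _ := Word d κ →₀ ℂ

namespace GNSSpace

variable {𝒲} {h𝒲 : IsWightmanFamily 𝒲}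

/-- The free module structure over words (group). [folklore] -/
instance : AddCommGroup (GNSSpace 𝒲 h𝒲) := inferInstanceAs (AddCommGroup (Word d κ →₀ ℂ))

/-- The free module structure over words (`ℂ`-module). [folklore] -/
instance : Module ℂ (GNSSpace 𝒲 h𝒲) := inferInstanceAs (Module ℂ (Word d κ →₀ ℂ))

variable (𝒲 h𝒲) in
/-- The identification of the free module over words with `GNSSpace`. [folklore] -/
def of : (Word d κ →₀ ℂ) ≃ₗ[ℂ] GNSSpace 𝒲 h𝒲 := LinearEquiv.refl ℂ _

variable (𝒲 h𝒲) in
/-- The basis vector `δ_l` of a word (the tensor monomial `f₁ ⊗ ⋯ ⊗ fₙ` with its labels). [folklore] -/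
def δ (l : Word d κ) : GNSSpace 𝒲 h𝒲 := of 𝒲 h𝒲 (Finsupp.single l 1)

/-- The positive hermitian form of Streater–Wightman (3-48) as a `PreInnerProductSpace.Core`
(hermitian by (c), positive semidefinite by (e)). [cite: StreaterWightman1964, §3-4 eq. (3-48)] -/
instance instCore : PreInnerProductSpace.Core ℂ (GNSSpace 𝒲 h𝒲) where
  inner v v' := innerFree 𝒲 ((of 𝒲 h𝒲).symm v) ((of 𝒲 h𝒲).symm v')
  conj_inner_symm x y := conj_innerFree 𝒲 h𝒲.hermitian _ _
  re_inner_nonneg x := (Complex.nonneg_iff.1 (innerFree_self_nonneg 𝒲 h𝒲.positive _)).1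
  add_left x y z := by
    simp only [map_add, innerFree_add_left]
  smul_left x y r := by
    simp only [map_smul, innerFree_smul_left]

/-- The seminormed group structure `‖v‖ = √⟪v, v⟫` (null vectors are allowed). [folklore] -/
instance instSeminormedAddCommGroup : SeminormedAddCommGroup (GNSSpace 𝒲 h𝒲) :=
  @InnerProductSpace.Core.toSeminormedAddCommGroup ℂ _ _ _ _ instCore

/-- The (semi-)inner product space structure. [folklore] -/
instance instInnerProductSpace : InnerProductSpace ℂ (GNSSpace 𝒲 h𝒲) :=
  InnerProductSpace.ofCore instCore

/-- The inner product is the form (3-48). [folklore] -/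
theorem inner_def (v v' : GNSSpace 𝒲 h𝒲) :
    ⟪v, v'⟫_ℂ = innerFree 𝒲 ((of 𝒲 h𝒲).symm v) ((of 𝒲 h𝒲).symm v') := rfl

/-- `⟪δ_l, δ_{l'}⟫ = 𝒲(l† ++ l')`. [folklore] -/
@[simp] theorem inner_δ_δ (l l' : Word d κ) : ⟪δ 𝒲 h𝒲 l, δ 𝒲 h𝒲 l'⟫_ℂ = pairing 𝒲 l l' := by
  rw [inner_def]
  change innerFree 𝒲 (Finsupp.single l 1) (Finsupp.single l' 1) = _
  simp

/-- The inner product of two images of the free module, as a double sum. [folklore] -/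
theorem inner_of_of (v v' : Word d κ →₀ ℂ) :
    ⟪of 𝒲 h𝒲 v, of 𝒲 h𝒲 v'⟫_ℂ =
      ∑ l ∈ v.support, ∑ l' ∈ v'.support, conj (v l) * v' l' * pairing 𝒲 l l' :=
  innerFree_eq_sum 𝒲 v v'

/-- Every vector is a finite combination of the `δ_l`. [folklore] -/
theorem of_eq_sum (v : Word d κ →₀ ℂ) : of 𝒲 h𝒲 v = ∑ l ∈ v.support, v l • δ 𝒲 h𝒲 l := by
  conv_lhs => rw [← Finsupp.sum_single v]
  rw [Finsupp.sum, map_sum]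
  refine Finset.sum_congr rfl fun l _ => ?_
  rw [δ, ← map_smul, Finsupp.smul_single_one]

/-- A vector orthogonal to itself is orthogonal to everything (Cauchy–Schwarz in the
semi-inner-product space). [folklore] -/
theorem inner_eq_zero_of_norm_eq_zero {v : GNSSpace 𝒲 h𝒲} (hv : ‖v‖ = 0) (w : GNSSpace 𝒲 h𝒲) :
    ⟪w, v⟫_ℂ = 0 := by
  have h := norm_inner_le_norm (𝕜 := ℂ) w v
  rw [hv, mul_zero] at h
  exact norm_eq_zero.1 (le_antisymm h (norm_nonneg _))

/-- `‖v‖ = 0` iff `v` is orthogonal to everything. [folklore] -/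
theorem norm_eq_zero_iff_inner {v : GNSSpace 𝒲 h𝒲} : ‖v‖ = 0 ↔ ∀ w, ⟪w, v⟫_ℂ = 0 := by
  refine ⟨fun hv w => inner_eq_zero_of_norm_eq_zero hv w, fun h => ?_⟩
  have h2 := inner_self_eq_norm_sq_to_K (𝕜 := ℂ) v
  rw [h v] at h2
  have h3 : ((‖v‖ : ℝ) : ℂ) = 0 := (pow_eq_zero_iff two_ne_zero).1 h2.symm
  exact_mod_cast h3

/-- Every vector of `GNSSpace` comes from the free module (the identification `of`). [folklore] -/
theorem of_symm_eq (v : GNSSpace 𝒲 h𝒲) : of 𝒲 h𝒲 ((of 𝒲 h𝒲).symm v) = v :=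
  LinearEquiv.apply_symm_apply _ _

/-- Inner products against a vector vanish as soon as they vanish against all `δ_l`. [folklore] -/
theorem inner_eq_zero_of_forall_δ {x : GNSSpace 𝒲 h𝒲} (h : ∀ l, ⟪δ 𝒲 h𝒲 l, x⟫_ℂ = 0)
    (w : GNSSpace 𝒲 h𝒲) : ⟪w, x⟫_ℂ = 0 := by
  rw [← of_symm_eq w, of_eq_sum, sum_inner]
  refine Finset.sum_eq_zero fun l _ => ?_
  rw [inner_smul_left, h l, mul_zero]

/-- A vector is null as soon as it is orthogonal to all `δ_l`. [folklore] -/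
theorem norm_eq_zero_of_forall_δ {x : GNSSpace 𝒲 h𝒲} (h : ∀ l, ⟪δ 𝒲 h𝒲 l, x⟫_ℂ = 0) :
    ‖x‖ = 0 :=
  norm_eq_zero_iff_inner.2 (inner_eq_zero_of_forall_δ h)

/-- `⟪δ_l, v⟫ = ∑_{l'} v_{l'} 𝒲(l† ++ l')`. [folklore] -/
theorem inner_δ_of (l : Word d κ) (v : Word d κ →₀ ℂ) :
    ⟪δ 𝒲 h𝒲 l, of 𝒲 h𝒲 v⟫_ℂ = ∑ l' ∈ v.support, v l' * pairing 𝒲 l l' := by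
  rw [of_eq_sum, inner_sum]
  refine Finset.sum_congr rfl fun l' _ => ?_
  rw [inner_smul_right, inner_δ_δ]

/-- `⟪δ_l, v⟫` after an injective relabelling of the basis. [folklore] -/
theorem inner_δ_of_mapDomain (l : Word d κ) {φ : Word d κ → Word d κ} (hφ : Function.Injective φ)
    (v : Word d κ →₀ ℂ) :
    ⟪δ 𝒲 h𝒲 l, of 𝒲 h𝒲 (Finsupp.mapDomain φ v)⟫_ℂ = ∑ l' ∈ v.support, v l' * pairing 𝒲 l (φ l') := by
  classical
  rw [inner_δ_of, Finsupp.mapDomain_support_of_injective hφ, Finset.sum_image hφ.injOn]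
  refine Finset.sum_congr rfl fun l' _ => ?_
  rw [Finsupp.mapDomain_apply hφ]

/-! ### Creation operators -/

variable (𝒲 h𝒲) in
/-- The **creation operator** of a labelled test function on the free space:
`δ_l ↦ δ_{(k,f) :: l}`, i.e. `f₁ ⊗ ⋯ ⊗ fₙ ↦ f ⊗ f₁ ⊗ ⋯ ⊗ fₙ` (Streater–Wightman (1964), §3-4,
eq. (3-50): the field `φ(h)` acts on sequences by tensoring on the left). [cite: StreaterWightman1964, §3-4 eq. (3-50)] -/
def create (p : κ × 𝓢(SpaceTime d, ℂ)) : GNSSpace 𝒲 h𝒲 →ₗ[ℂ] GNSSpace 𝒲 h𝒲 :=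
  (of 𝒲 h𝒲).toLinearMap ∘ₗ Finsupp.lmapDomain ℂ ℂ (List.cons p) ∘ₗ (of 𝒲 h𝒲).symm.toLinearMap

/-- The creation operator relabels the basis by `List.cons`. [folklore] -/
theorem create_of (p : κ × 𝓢(SpaceTime d, ℂ)) (v : Word d κ →₀ ℂ) :
    create 𝒲 h𝒲 p (of 𝒲 h𝒲 v) = of 𝒲 h𝒲 (Finsupp.mapDomain (List.cons p) v) := by
  simp only [create, LinearMap.comp_apply, LinearEquiv.coe_toLinearMap,
    LinearEquiv.symm_apply_apply, Finsupp.lmapDomain_apply]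

/-- `φ_p δ_l = δ_{p :: l}`. [folklore] -/
@[simp] theorem create_δ (p : κ × 𝓢(SpaceTime d, ℂ)) (l : Word d κ) :
    create 𝒲 h𝒲 p (δ 𝒲 h𝒲 l) = δ 𝒲 h𝒲 (p :: l) := by
  rw [δ, create_of, Finsupp.mapDomain_single, δ]

/-- **The adjoint identity for creation operators**: `⟪φ_p v, v'⟫ = ⟪v, φ_{p̄} v'⟫` with
`p̄ = (k, f̄)` (Streater–Wightman (1964), §3-4 eq. (3-52)). [cite: StreaterWightman1964, §3-4 eq. (3-52)] -/
theorem inner_create_left (p : κ × 𝓢(SpaceTime d, ℂ)) (v v' : GNSSpace 𝒲 h𝒲) :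
    ⟪create 𝒲 h𝒲 p v, v'⟫_ℂ = ⟪v, create 𝒲 h𝒲 (p.1, starTest p.2) v'⟫_ℂ := by
  have key : ∀ u u' : Word d κ →₀ ℂ, ⟪create 𝒲 h𝒲 p (of 𝒲 h𝒲 u), of 𝒲 h𝒲 u'⟫_ℂ =
      ⟪of 𝒲 h𝒲 u, create 𝒲 h𝒲 (p.1, starTest p.2) (of 𝒲 h𝒲 u')⟫_ℂ := by
    intro u u'
    rw [create_of, create_of, inner_def, inner_def]
    simp only [LinearEquiv.symm_apply_apply]
    rw [← (Finsupp.mapDomain_id : Finsupp.mapDomain id u' = u'), innerFree_mapDomain,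
      Finsupp.mapDomain_id, ← (Finsupp.mapDomain_id : Finsupp.mapDomain id u = u),
      innerFree_mapDomain, Finsupp.mapDomain_id]
    refine Finset.sum_congr rfl fun l _ => Finset.sum_congr rfl fun l' _ => ?_
    rw [id, id, pairing_cons_left]
  simpa only [of_symm_eq] using key ((of 𝒲 h𝒲).symm v) ((of 𝒲 h𝒲).symm v')

/-- A vector with `⟪x, x⟫ = 0` has seminorm `0`. [folklore] -/
theorem norm_eq_zero_of_inner_self {x : GNSSpace 𝒲 h𝒲} (h : ⟪x, x⟫_ℂ = 0) : ‖x‖ = 0 := by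
  rw [inner_self_eq_norm_sq_to_K] at h
  have h2 : ((‖x‖ : ℝ) : ℂ) = 0 := (pow_eq_zero_iff two_ne_zero).1 h
  exact_mod_cast h2

/-- Creation operators preserve null vectors (the null space is a left ideal):
`‖φ_p v‖² = ⟪v, φ_{p̄} φ_p v⟫ = 0`. [folklore] -/
theorem norm_create_eq_zero (p : κ × 𝓢(SpaceTime d, ℂ)) {v : GNSSpace 𝒲 h𝒲} (hv : ‖v‖ = 0) :
    ‖create 𝒲 h𝒲 p v‖ = 0 := by
  refine norm_eq_zero_of_inner_self ?_
  rw [inner_create_left, ← inner_conj_symm, inner_eq_zero_of_norm_eq_zero hv, map_zero]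

/-- Creation is additive in the test function up to null vectors. [folklore] -/
theorem norm_create_add_sub (k : κ) (f g : 𝓢(SpaceTime d, ℂ)) (v : GNSSpace 𝒲 h𝒲) :
    ‖create 𝒲 h𝒲 (k, f + g) v - create 𝒲 h𝒲 (k, f) v - create 𝒲 h𝒲 (k, g) v‖ = 0 := by
  rw [← of_symm_eq v]
  set u := (of 𝒲 h𝒲).symm v
  refine norm_eq_zero_of_forall_δ fun l => ?_
  simp only [inner_sub_right, create_of, inner_δ_of_mapDomain _ List.cons_injective,
    ← Finset.sum_sub_distrib]
  refine Finset.sum_eq_zero fun l' _ => ?_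
  simp only [pairing, eval_append_cons_add]
  ring

/-- Creation is homogeneous in the test function up to null vectors. [folklore] -/
theorem norm_create_smul_sub (k : κ) (c : ℂ) (f : 𝓢(SpaceTime d, ℂ)) (v : GNSSpace 𝒲 h𝒲) :
    ‖create 𝒲 h𝒲 (k, c • f) v - c • create 𝒲 h𝒲 (k, f) v‖ = 0 := by
  rw [← of_symm_eq v]
  set u := (of 𝒲 h𝒲).symm v
  refine norm_eq_zero_of_forall_δ fun l => ?_
  simp only [inner_sub_right, inner_smul_right, create_of,
    inner_δ_of_mapDomain _ List.cons_injective, Finset.mul_sum, ← Finset.sum_sub_distrib]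
  refine Finset.sum_eq_zero fun l' _ => ?_
  simp only [pairing, eval_append_cons_smul]
  ring

/-- **Local commutativity of creation operators up to null vectors** from (d): if the supports
of `f` and `g` are spacelike separated then `φ_{(k,f)} φ_{(k',g)} v - φ_{(k',g)} φ_{(k,f)} v` is a
null vector (Streater–Wightman (1964), §3-4 eq. (3-53)). [cite: StreaterWightman1964, §3-4 eq. (3-53)] -/
theorem norm_create_create_sub (hd : IsLocalFamily 𝒲) (p q : κ × 𝓢(SpaceTime d, ℂ))
    (hpq : AreSpacelikeSeparated (tsupport (p.2 : SpaceTime d → ℂ))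
      (tsupport (q.2 : SpaceTime d → ℂ)))
    (v : GNSSpace 𝒲 h𝒲) :
    ‖create 𝒲 h𝒲 p (create 𝒲 h𝒲 q v) - create 𝒲 h𝒲 q (create 𝒲 h𝒲 p v)‖ = 0 := by
  rw [← of_symm_eq v]
  set u := (of 𝒲 h𝒲).symm v
  have hinj : Function.Injective (List.cons p ∘ List.cons q : Word d κ → Word d κ) :=
    List.cons_injective.comp List.cons_injective
  have hinj' : Function.Injective (List.cons q ∘ List.cons p : Word d κ → Word d κ) :=
    List.cons_injective.comp List.cons_injective
  refine norm_eq_zero_of_forall_δ fun l => ?_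
  simp only [inner_sub_right, create_of, ← Finsupp.mapDomain_comp]
  rw [inner_δ_of_mapDomain _ hinj, inner_δ_of_mapDomain _ hinj', ← Finset.sum_sub_distrib]
  refine Finset.sum_eq_zero fun l' _ => ?_
  simp only [Function.comp_apply, pairing]
  rw [eval_append_cons_cons_comm 𝒲 hd _ _ p q hpq, sub_self]

/-! ### The Poincaré action on the free space -/

variable (𝒲 h𝒲) in
/-- The **Poincaré action** on the free space, letterwise: `δ_l ↦ δ_{g • l}`
(Streater–Wightman (1964), §3-4 eq. (3-49): `U(a, Λ)` on sequences). [cite: StreaterWightman1964, §3-4 eq. (3-49)] -/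
def act (g : PoincareGroup d) : GNSSpace 𝒲 h𝒲 →ₗ[ℂ] GNSSpace 𝒲 h𝒲 :=
  (of 𝒲 h𝒲).toLinearMap ∘ₗ Finsupp.lmapDomain ℂ ℂ (List.map (actLetter g)) ∘ₗ
    (of 𝒲 h𝒲).symm.toLinearMap

/-- The action relabels the basis letterwise. [folklore] -/
theorem act_of (g : PoincareGroup d) (v : Word d κ →₀ ℂ) :
    act 𝒲 h𝒲 g (of 𝒲 h𝒲 v) = of 𝒲 h𝒲 (Finsupp.mapDomain (List.map (actLetter g)) v) := by
  simp only [act, LinearMap.comp_apply, LinearEquiv.coe_toLinearMap,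
    LinearEquiv.symm_apply_apply, Finsupp.lmapDomain_apply]

/-- `U(g) δ_l = δ_{g • l}`. [folklore] -/
@[simp] theorem act_δ (g : PoincareGroup d) (l : Word d κ) :
    act 𝒲 h𝒲 g (δ 𝒲 h𝒲 l) = δ 𝒲 h𝒲 (l.map (actLetter g)) := by
  rw [δ, act_of, Finsupp.mapDomain_single, δ]

/-- The action is a representation: `U(g g') = U(g) U(g')`. [folklore] -/
theorem act_mul (g g' : PoincareGroup d) :
    act 𝒲 h𝒲 (g * g') = act 𝒲 h𝒲 g ∘ₗ act 𝒲 h𝒲 g' := by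
  refine LinearMap.ext fun v => ?_
  rw [← of_symm_eq v]
  set u := (of 𝒲 h𝒲).symm v
  simp only [LinearMap.comp_apply, act_of, ← Finsupp.mapDomain_comp]
  congr 2
  funext l
  simp [Function.comp_def, actLetter_mul]

/-- `U(1) = 1`. [folklore] -/
theorem act_one : act 𝒲 h𝒲 (1 : PoincareGroup d) = LinearMap.id := by
  refine LinearMap.ext fun v => ?_
  rw [← of_symm_eq v]
  set u := (of 𝒲 h𝒲).symm v
  rw [act_of, LinearMap.id_apply]
  congr 1
  have h1 : (List.map (actLetter (1 : PoincareGroup d)) : Word d κ → Word d κ) = id := by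
    funext l
    rw [id]
    conv_rhs => rw [← List.map_id l]
    exact List.map_congr_left fun p _ => actLetter_one p
  rw [h1, Finsupp.mapDomain_id]

/-- **The action is isometric** by (a): `⟪U(g) v, U(g) v'⟫ = ⟪v, v'⟫`
(Streater–Wightman (1964), §3-4 eq. (3-49)). [cite: StreaterWightman1964, §3-4 eq. (3-49)] -/
theorem inner_act_act (g : PoincareGroup d) (v v' : GNSSpace 𝒲 h𝒲) :
    ⟪act 𝒲 h𝒲 g v, act 𝒲 h𝒲 g v'⟫_ℂ = ⟪v, v'⟫_ℂ := by
  rw [← of_symm_eq v, ← of_symm_eq v']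
  set u := (of 𝒲 h𝒲).symm v
  set u' := (of 𝒲 h𝒲).symm v'
  rw [act_of, act_of, inner_def, inner_of_of]
  simp only [LinearEquiv.symm_apply_apply]
  rw [innerFree_mapDomain]
  refine Finset.sum_congr rfl fun l _ => Finset.sum_congr rfl fun l' _ => ?_
  rw [pairing_map_actLetter 𝒲 h𝒲.poincare_invariant]

/-- The action preserves the seminorm. [folklore] -/
theorem norm_act (g : PoincareGroup d) (v : GNSSpace 𝒲 h𝒲) : ‖act 𝒲 h𝒲 g v‖ = ‖v‖ := by
  have h := inner_act_act g v v
  rw [inner_self_eq_norm_sq_to_K, inner_self_eq_norm_sq_to_K] at h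
  have h' : (‖act 𝒲 h𝒲 g v‖ : ℝ) ^ 2 = ‖v‖ ^ 2 := by exact_mod_cast h
  exact (sq_eq_sq₀ (norm_nonneg _) (norm_nonneg _)).1 h'

/-- The vacuum vector `δ_{[]}` is invariant. [folklore] -/
theorem act_δ_nil (g : PoincareGroup d) : act 𝒲 h𝒲 g (δ 𝒲 h𝒲 []) = δ 𝒲 h𝒲 [] := by
  rw [act_δ, List.map_nil]

/-- **Covariance on the free space**: `U(g) φ_{(k,f)} = φ_{(k, g • f)} U(g)`. [folklore] -/
theorem act_create (g : PoincareGroup d) (p : κ × 𝓢(SpaceTime d, ℂ)) (v : GNSSpace 𝒲 h𝒲) :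
    act 𝒲 h𝒲 g (create 𝒲 h𝒲 p v) = create 𝒲 h𝒲 (actLetter g p) (act 𝒲 h𝒲 g v) := by
  rw [← of_symm_eq v]
  set u := (of 𝒲 h𝒲).symm v
  simp only [act_of, create_of, ← Finsupp.mapDomain_comp]
  rfl

end GNSSpace

/-! ## The Hilbert space, the dense domain and the operators -/

/-- The **GNS Hilbert space** of the Wightman family: the completion of `GNSSpace` (which also
identifies the null vectors of the semidefinite form) (Streater–Wightman (1964), §3-4,
pp. 118–119). [cite: StreaterWightman1964, §3-4] -/
abbrev GNSHilbert (h𝒲 : IsWightmanFamily 𝒲) : Type _ := UniformSpace.Completion (GNSSpace 𝒲 h𝒲)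

namespace GNSSpace

variable {𝒲} {h𝒲 : IsWightmanFamily 𝒲}

variable (𝒲 h𝒲) in
/-- The canonical isometric linear map `GNSSpace → GNSHilbert` (coercion into the completion). [folklore] -/
def ι : GNSSpace 𝒲 h𝒲 →ₗᵢ[ℂ] GNSHilbert 𝒲 h𝒲 := UniformSpace.Completion.toComplₗᵢ

/-- `ι` is the coercion into the completion. [folklore] -/
theorem ι_apply (v : GNSSpace 𝒲 h𝒲) : ι 𝒲 h𝒲 v = (v : GNSHilbert 𝒲 h𝒲) := rfl

/-- `ι` has dense range. [folklore] -/
theorem denseRange_ι : DenseRange (ι 𝒲 h𝒲) := by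
  rw [show (ι 𝒲 h𝒲 : GNSSpace 𝒲 h𝒲 → GNSHilbert 𝒲 h𝒲) = ((↑) : _ → _) from rfl]
  exact UniformSpace.Completion.denseRange_coe

/-- `ι` has dense range (linear-map form). [folklore] -/
theorem denseRange_ι_linear : DenseRange (ι 𝒲 h𝒲).toLinearMap := denseRange_ι

/-- `ι` preserves inner products. [folklore] -/
@[simp] theorem inner_ι_ι (v v' : GNSSpace 𝒲 h𝒲) : ⟪ι 𝒲 h𝒲 v, ι 𝒲 h𝒲 v'⟫_ℂ = ⟪v, v'⟫_ℂ :=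
  (ι 𝒲 h𝒲).inner_map_map v v'

/-- `ι` preserves the (semi)norm. [folklore] -/
@[simp] theorem norm_ι (v : GNSSpace 𝒲 h𝒲) : ‖ι 𝒲 h𝒲 v‖ = ‖v‖ := (ι 𝒲 h𝒲).norm_map v

/-- `ι v = 0` iff `v` is a null vector. [folklore] -/
theorem ι_eq_zero_iff {v : GNSSpace 𝒲 h𝒲} : ι 𝒲 h𝒲 v = 0 ↔ ‖v‖ = 0 := by
  rw [← norm_eq_zero (E := GNSHilbert 𝒲 h𝒲), norm_ι]

/-- Two vectors with null difference have the same image in the Hilbert space. [folklore] -/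
theorem ι_eq_ι_of_norm_sub {v v' : GNSSpace 𝒲 h𝒲} (h : ‖v - v'‖ = 0) : ι 𝒲 h𝒲 v = ι 𝒲 h𝒲 v' := by
  rw [← sub_eq_zero, ← map_sub, ι_eq_zero_iff, h]

variable (𝒲 h𝒲) in
/-- The **dense domain** `D₀`: the image of the free space in the Hilbert space, i.e. the span of
the (classes of the) tensor monomials (Streater–Wightman (1964), §3-4, the domain `D` of the
reconstructed fields). [cite: StreaterWightman1964, §3-4] -/
def dom : Submodule ℂ (GNSHilbert 𝒲 h𝒲) := LinearMap.range (ι 𝒲 h𝒲).toLinearMap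

variable (𝒲 h𝒲) in
/-- The corestriction `GNSSpace → D₀` (surjective). [folklore] -/
def ιr : GNSSpace 𝒲 h𝒲 →ₗ[ℂ] dom 𝒲 h𝒲 := (ι 𝒲 h𝒲).toLinearMap.rangeRestrict

/-- The corestriction followed by the inclusion is `ι`. [folklore] -/
@[simp] theorem coe_ιr (v : GNSSpace 𝒲 h𝒲) : (ιr 𝒲 h𝒲 v : GNSHilbert 𝒲 h𝒲) = ι 𝒲 h𝒲 v := rfl

/-- The corestriction onto `D₀` is surjective. [folklore] -/
theorem ιr_surjective : Function.Surjective (ιr 𝒲 h𝒲) := LinearMap.surjective_rangeRestrict _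

/-- The kernel of the corestriction is the null space. [folklore] -/
theorem mem_ker_ιr_iff {v : GNSSpace 𝒲 h𝒲} : v ∈ LinearMap.ker (ιr 𝒲 h𝒲) ↔ ‖v‖ = 0 := by
  rw [LinearMap.mem_ker, ← ι_eq_zero_iff, Subtype.ext_iff, coe_ιr]
  rfl

/-- Vectors with null difference have the same class in `D₀`. [folklore] -/
theorem ιr_eq_ιr_of_norm_sub {v v' : GNSSpace 𝒲 h𝒲} (h : ‖v - v'‖ = 0) :
    ιr 𝒲 h𝒲 v = ιr 𝒲 h𝒲 v' :=
  Subtype.ext (ι_eq_ι_of_norm_sub h)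

/-- **W1/W4: the domain `D₀` is dense**. [folklore] -/
theorem dense_dom : Dense (dom 𝒲 h𝒲 : Set (GNSHilbert 𝒲 h𝒲)) := by
  rw [dom, LinearMap.coe_range]
  exact denseRange_ι

/-! ### The field operators on `D₀` -/

variable (𝒲 h𝒲) in
/-- The **field operator** `φ_{(k,f)} : D₀ → D₀` induced by the creation operator (well defined
since creation preserves null vectors, `norm_create_eq_zero`) (Streater–Wightman (1964), §3-4,
eq. (3-50)). [cite: StreaterWightman1964, §3-4 eq. (3-50)] -/
def fieldOp (p : κ × 𝓢(SpaceTime d, ℂ)) : dom 𝒲 h𝒲 →ₗ[ℂ] dom 𝒲 h𝒲 :=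
  (LinearMap.ker (ιr 𝒲 h𝒲)).liftQ (ιr 𝒲 h𝒲 ∘ₗ create 𝒲 h𝒲 p) (fun v hv => by
      rw [LinearMap.mem_ker, LinearMap.comp_apply, ← LinearMap.mem_ker, mem_ker_ιr_iff]
      exact norm_create_eq_zero p (mem_ker_ιr_iff.1 hv)) ∘ₗ
    ((ιr 𝒲 h𝒲).quotKerEquivOfSurjective ιr_surjective).symm.toLinearMap

/-- **The field operator on classes**: `φ_p [v] = [φ_p v]`. [folklore] -/
@[simp] theorem fieldOp_ιr (p : κ × 𝓢(SpaceTime d, ℂ)) (v : GNSSpace 𝒲 h𝒲) :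
    fieldOp 𝒲 h𝒲 p (ιr 𝒲 h𝒲 v) = ιr 𝒲 h𝒲 (create 𝒲 h𝒲 p v) := by
  simp only [fieldOp, LinearMap.comp_apply, LinearEquiv.coe_toLinearMap,
    LinearMap.quotKerEquivOfSurjective_symm_apply, Submodule.liftQ_apply]

/-- The field operator is additive in the test function (null defect `norm_create_add_sub`). [folklore] -/
theorem fieldOp_add (k : κ) (f g : 𝓢(SpaceTime d, ℂ)) :
    fieldOp 𝒲 h𝒲 (k, f + g) = fieldOp 𝒲 h𝒲 (k, f) + fieldOp 𝒲 h𝒲 (k, g) := by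
  refine LinearMap.ext fun ψ => ?_
  obtain ⟨v, rfl⟩ := ιr_surjective ψ
  rw [LinearMap.add_apply, fieldOp_ιr, fieldOp_ιr, fieldOp_ιr, ← map_add (ιr 𝒲 h𝒲)]
  refine ιr_eq_ιr_of_norm_sub ?_
  rw [← sub_sub]
  exact norm_create_add_sub k f g v

/-- The field operator is homogeneous in the test function. [folklore] -/
theorem fieldOp_smul (k : κ) (c : ℂ) (f : 𝓢(SpaceTime d, ℂ)) :
    fieldOp 𝒲 h𝒲 (k, c • f) = c • fieldOp 𝒲 h𝒲 (k, f) := by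
  refine LinearMap.ext fun ψ => ?_
  obtain ⟨v, rfl⟩ := ιr_surjective ψ
  rw [LinearMap.smul_apply, fieldOp_ιr, fieldOp_ιr, ← map_smul (ιr 𝒲 h𝒲)]
  exact ιr_eq_ιr_of_norm_sub (norm_create_smul_sub k c f v)

variable (𝒲 h𝒲) in
/-- The field as a linear map in the test function, `f ↦ φ_k(f) : D₀ → D₀`
(Streater–Wightman (1964), §3-4 eq. (3-50), linear in `h`). [cite: StreaterWightman1964, §3-4 eq. (3-50)] -/
def field (k : κ) : 𝓢(SpaceTime d, ℂ) →ₗ[ℂ] (dom 𝒲 h𝒲 →ₗ[ℂ] dom 𝒲 h𝒲) where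
  toFun f := fieldOp 𝒲 h𝒲 (k, f)
  map_add' f g := fieldOp_add k f g
  map_smul' c f := fieldOp_smul k c f

/-- Unfolding of `field`. [folklore] -/
@[simp] theorem field_apply (k : κ) (f : 𝓢(SpaceTime d, ℂ)) :
    field 𝒲 h𝒲 k f = fieldOp 𝒲 h𝒲 (k, f) := rfl

/-- **Hermiticity W1**: `⟪χ, φ_k(f) ψ⟫ = conj ⟪ψ, φ_k(f̄) χ⟫` on `D₀`
(Streater–Wightman (1964), §3-4 eq. (3-52)). [cite: StreaterWightman1964, §3-4 eq. (3-52)] -/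
theorem inner_fieldOp_hermitian (k : κ) (f : 𝓢(SpaceTime d, ℂ)) (ψ χ : dom 𝒲 h𝒲) :
    ⟪(χ : GNSHilbert 𝒲 h𝒲), (fieldOp 𝒲 h𝒲 (k, f) ψ : GNSHilbert 𝒲 h𝒲)⟫_ℂ =
      conj ⟪(ψ : GNSHilbert 𝒲 h𝒲), (fieldOp 𝒲 h𝒲 (k, starTest f) χ : GNSHilbert 𝒲 h𝒲)⟫_ℂ := by
  obtain ⟨v, rfl⟩ := ιr_surjective ψ
  obtain ⟨u, rfl⟩ := ιr_surjective χ
  simp only [fieldOp_ιr, coe_ιr, inner_ι_ι]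
  rw [← inner_conj_symm, inner_create_left]

/-- **Locality W3** on `D₀`: fields smeared with spacelike-separated test functions commute
(Streater–Wightman (1964), §3-4 eq. (3-53)). [cite: StreaterWightman1964, §3-4 eq. (3-53)] -/
theorem fieldOp_comm (k k' : κ) (f g : 𝓢(SpaceTime d, ℂ)) (ψ : dom 𝒲 h𝒲)
    (h : AreSpacelikeSeparated (tsupport (f : SpaceTime d → ℂ)) (tsupport (g : SpaceTime d → ℂ))) :
    fieldOp 𝒲 h𝒲 (k, f) (fieldOp 𝒲 h𝒲 (k', g) ψ) = fieldOp 𝒲 h𝒲 (k', g) (fieldOp 𝒲 h𝒲 (k, f) ψ) := by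
  obtain ⟨v, rfl⟩ := ιr_surjective ψ
  simp only [fieldOp_ιr]
  exact ιr_eq_ιr_of_norm_sub (norm_create_create_sub h𝒲.local_comm (k, f) (k', g) h v)

/-! ### The vacuum -/

variable (𝒲 h𝒲) in
/-- The **vacuum vector** `Ω = [δ_{[]}]` (the class of the empty tensor, the sequence
`(1, 0, 0, …)`) (Streater–Wightman (1964), §3-4, text following (3-49)). [cite: StreaterWightman1964, §3-4, text following (3-49)] -/
def vacuum : GNSHilbert 𝒲 h𝒲 := ι 𝒲 h𝒲 (δ 𝒲 h𝒲 [])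

/-- `Ω ∈ D₀`. [folklore] -/
theorem vacuum_mem_dom : vacuum 𝒲 h𝒲 ∈ dom 𝒲 h𝒲 := LinearMap.mem_range_self _ _

/-- `Ω` as an element of `D₀` is the class of `δ_{[]}`. [folklore] -/
theorem vacuumDom_eq : (⟨vacuum 𝒲 h𝒲, vacuum_mem_dom⟩ : dom 𝒲 h𝒲) = ιr 𝒲 h𝒲 (δ 𝒲 h𝒲 []) := rfl

/-- `𝒲([]) = 1` from the normalisation `𝒲₀ = 1`. [folklore] -/
theorem eval_nil (h0 : IsNormalisedFamily 𝒲) : eval 𝒲 ([] : Word d κ) = 1 := by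
  change 𝒲 0 (wordLab []) (wordTensor []) = 1
  rw [h0]
  exact wordTensor_apply [] _

/-- `‖Ω‖ = 1`. [folklore] -/
theorem norm_vacuum : ‖vacuum 𝒲 h𝒲‖ = 1 := by
  have h : ⟪vacuum 𝒲 h𝒲, vacuum 𝒲 h𝒲⟫_ℂ = 1 := by
    rw [vacuum, inner_ι_ι, inner_δ_δ, pairing, WightmanData.starList_nil, List.nil_append]
    exact eval_nil h𝒲.normalised
  have h' : ‖vacuum 𝒲 h𝒲‖ ^ 2 = 1 := by
    rw [← inner_self_eq_norm_sq (𝕜 := ℂ), h]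
    simp
  exact (pow_eq_one_iff_of_nonneg (norm_nonneg _) two_ne_zero).1 h'

/-! ### The unitary representation of the Poincaré group -/

variable (𝒲 h𝒲) in
/-- The Poincaré action as a linear automorphism of the free space. [folklore] -/
def actEquiv (g : PoincareGroup d) : GNSSpace 𝒲 h𝒲 ≃ₗ[ℂ] GNSSpace 𝒲 h𝒲 :=
  LinearEquiv.ofLinear (act 𝒲 h𝒲 g) (act 𝒲 h𝒲 g⁻¹)
    (by rw [← act_mul, mul_inv_cancel, act_one])
    (by rw [← act_mul, inv_mul_cancel, act_one])

/-- Unfolding of `actEquiv`. [folklore] -/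
@[simp] theorem actEquiv_apply (g : PoincareGroup d) (v : GNSSpace 𝒲 h𝒲) :
    actEquiv 𝒲 h𝒲 g v = act 𝒲 h𝒲 g v := rfl

variable (𝒲 h𝒲) in
/-- **The unitary operator `U(g)`** on the GNS Hilbert space: the extension by continuity of the
isometric action on the free space (Streater–Wightman (1964), §3-4 eq. (3-49)). [cite: StreaterWightman1964, §3-4 eq. (3-49)] -/
def U (g : PoincareGroup d) : GNSHilbert 𝒲 h𝒲 ≃ₗᵢ[ℂ] GNSHilbert 𝒲 h𝒲 :=
  (actEquiv 𝒲 h𝒲 g).extendOfIsometry (ι 𝒲 h𝒲).toLinearMap (ι 𝒲 h𝒲).toLinearMap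
    denseRange_ι_linear denseRange_ι_linear (fun v => by simp [norm_act])

/-- `U(g) [v] = [g • v]`. [folklore] -/
@[simp] theorem U_ι (g : PoincareGroup d) (v : GNSSpace 𝒲 h𝒲) :
    U 𝒲 h𝒲 g (ι 𝒲 h𝒲 v) = ι 𝒲 h𝒲 (act 𝒲 h𝒲 g v) := by
  rw [U, LinearEquiv.extendOfIsometry_apply]
  exact LinearMap.extendOfNorm_eq denseRange_ι_linear ⟨1, fun x => by simp [norm_act]⟩ v

/-- `U` is a representation: `U(g g') = U(g) U(g')`. [folklore] -/
theorem U_mul_apply (g g' : PoincareGroup d) (x : GNSHilbert 𝒲 h𝒲) :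
    U 𝒲 h𝒲 (g * g') x = U 𝒲 h𝒲 g (U 𝒲 h𝒲 g' x) := by
  refine denseRange_ι.induction_on x ?_ (fun v => ?_)
  · exact isClosed_eq (U 𝒲 h𝒲 (g * g')).continuous
      ((U 𝒲 h𝒲 g).continuous.comp (U 𝒲 h𝒲 g').continuous)
  · simp only [U_ι, act_mul, LinearMap.comp_apply]

/-- `U(1) = 1`. [folklore] -/
theorem U_one_apply (x : GNSHilbert 𝒲 h𝒲) : U 𝒲 h𝒲 (1 : PoincareGroup d) x = x := by
  refine denseRange_ι.induction_on x
    (isClosed_eq (U 𝒲 h𝒲 (1 : PoincareGroup d)).continuous continuous_id) (fun v => ?_)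
  simp only [U_ι, act_one, LinearMap.id_apply]

/-- `U(g) Ω = Ω`. [folklore] -/
@[simp] theorem U_vacuum (g : PoincareGroup d) : U 𝒲 h𝒲 g (vacuum 𝒲 h𝒲) = vacuum 𝒲 h𝒲 := by
  rw [vacuum, U_ι, act_δ_nil]

/-- `U(g)` maps `D₀` into itself. [folklore] -/
theorem U_mem_dom (g : PoincareGroup d) {ψ : GNSHilbert 𝒲 h𝒲} (hψ : ψ ∈ dom 𝒲 h𝒲) :
    U 𝒲 h𝒲 g ψ ∈ dom 𝒲 h𝒲 := by
  obtain ⟨v, rfl⟩ := hψ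
  exact ⟨act 𝒲 h𝒲 g v, by simp⟩

/-- **Covariance W2** on `D₀`: `U(g) φ_k(f) ψ = φ_k(g • f) U(g) ψ`
(Streater–Wightman (1964), §3-4 eq. (3-51)). [cite: StreaterWightman1964, §3-4 eq. (3-51)] -/
theorem U_fieldOp (g : PoincareGroup d) (k : κ) (f : 𝓢(SpaceTime d, ℂ)) (ψ : dom 𝒲 h𝒲)
    (hψ : U 𝒲 h𝒲 g ψ ∈ dom 𝒲 h𝒲) :
    U 𝒲 h𝒲 g (fieldOp 𝒲 h𝒲 (k, f) ψ : GNSHilbert 𝒲 h𝒲) =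
      (fieldOp 𝒲 h𝒲 (k, poincareTest g f) ⟨U 𝒲 h𝒲 g ψ, hψ⟩ : GNSHilbert 𝒲 h𝒲) := by
  obtain ⟨v, rfl⟩ := ιr_surjective ψ
  have hv : (⟨U 𝒲 h𝒲 g (ιr 𝒲 h𝒲 v), hψ⟩ : dom 𝒲 h𝒲) = ιr 𝒲 h𝒲 (act 𝒲 h𝒲 g v) :=
    Subtype.ext (by simp)
  rw [hv, fieldOp_ιr, fieldOp_ιr, coe_ιr, coe_ιr, U_ι, act_create]
  rfl

/-! ### Field monomials, the polynomial domain and the Wightman functions -/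

variable (𝒲 h𝒲) in
/-- The field monomial `φ(l) = φ_{k₁}(f₁) ⋯ φ_{kₙ}(fₙ) : D₀ → D₀` of a word (same recursion as
`WightmanData.fieldMonomial`). [folklore] -/
def fieldMonomialOp (l : Word d κ) : dom 𝒲 h𝒲 →ₗ[ℂ] dom 𝒲 h𝒲 :=
  l.foldr (fun p A => fieldOp 𝒲 h𝒲 (p.1, p.2) ∘ₗ A) LinearMap.id

/-- The empty monomial is the identity. [folklore] -/
@[simp] theorem fieldMonomialOp_nil : fieldMonomialOp 𝒲 h𝒲 [] = LinearMap.id := rfl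

/-- `φ(p :: l) = φ_p ∘ φ(l)`. [folklore] -/
@[simp] theorem fieldMonomialOp_cons (p : κ × 𝓢(SpaceTime d, ℂ)) (l : Word d κ) :
    fieldMonomialOp 𝒲 h𝒲 (p :: l) = fieldOp 𝒲 h𝒲 p ∘ₗ fieldMonomialOp 𝒲 h𝒲 l := rfl

/-- **Monomial vectors are classes of words**: `φ(l) Ω = [δ_l]`. [folklore] -/
theorem fieldMonomialOp_vacuum (l : Word d κ) :
    fieldMonomialOp 𝒲 h𝒲 l ⟨vacuum 𝒲 h𝒲, vacuum_mem_dom⟩ = ιr 𝒲 h𝒲 (δ 𝒲 h𝒲 l) := by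
  induction l with
  | nil => rfl
  | cons p l ih => rw [fieldMonomialOp_cons, LinearMap.comp_apply, ih, fieldOp_ιr, create_δ]

/-- `⟪Ω, φ(l) Ω⟫ = 𝒲(l)`: the vacuum expectation values of the reconstructed field monomials are
the given distributions on tensor monomials (Streater–Wightman (1964), §3-4, Thm. 3-7 (statement)). [cite: StreaterWightman1964, §3-4, Thm. 3-7 (statement)] -/
theorem inner_vacuum_fieldMonomialOp (l : Word d κ) :
    ⟪vacuum 𝒲 h𝒲, (fieldMonomialOp 𝒲 h𝒲 l ⟨vacuum 𝒲 h𝒲, vacuum_mem_dom⟩ : GNSHilbert 𝒲 h𝒲)⟫_ℂ =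
      eval 𝒲 l := by
  rw [fieldMonomialOp_vacuum, coe_ιr, vacuum, inner_ι_ι, inner_δ_δ, pairing,
    WightmanData.starList_nil, List.nil_append]

/-- **The domain is the polynomial domain**: `D₀ = span {φ(l) Ω}`
(Streater–Wightman (1964), §3-4: the domain of Thm. 3-7). [cite: StreaterWightman1964, §3-4] -/
theorem dom_eq_span : dom 𝒲 h𝒲 = Submodule.span ℂ (Set.range fun l : Word d κ =>
    (fieldMonomialOp 𝒲 h𝒲 l ⟨vacuum 𝒲 h𝒲, vacuum_mem_dom⟩ : GNSHilbert 𝒲 h𝒲)) := by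
  refine le_antisymm ?_ (Submodule.span_le.2 ?_)
  · rintro _ ⟨v, rfl⟩
    rw [LinearIsometry.coe_toLinearMap, ← of_symm_eq v, of_eq_sum, map_sum]
    refine Submodule.sum_mem _ fun l _ => ?_
    rw [map_smul]
    refine Submodule.smul_mem _ _ (Submodule.subset_span ⟨l, ?_⟩)
    simp only [fieldMonomialOp_vacuum, coe_ιr]
  · rintro _ ⟨l, rfl⟩
    exact (fieldMonomialOp 𝒲 h𝒲 l _).2

/-- **Cyclicity W4**: the monomial vectors span a dense subspace. [folklore] -/
theorem dense_span_fieldMonomialOp : Dense (Submodule.span ℂ (Set.range fun l : Word d κ =>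
    (fieldMonomialOp 𝒲 h𝒲 l ⟨vacuum 𝒲 h𝒲, vacuum_mem_dom⟩ : GNSHilbert 𝒲 h𝒲)) :
      Set (GNSHilbert 𝒲 h𝒲)) := by
  rw [← dom_eq_span]
  exact dense_dom

/-! ### Translations and Lorentz transformations separately -/

variable (𝒲 h𝒲) in
/-- The unitary representation of the restricted Lorentz group, `Λ ↦ U(0, Λ)`, valued in the
unitary group of `B(H)`. [folklore] -/
def lorHom : restrictedLorentzGroup d →* unitary (GNSHilbert 𝒲 h𝒲 →L[ℂ] GNSHilbert 𝒲 h𝒲) where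
  toFun Λ := Unitary.linearIsometryEquiv.symm (U 𝒲 h𝒲 (SemidirectProduct.inr Λ))
  map_one' := by
    rw [← map_one Unitary.linearIsometryEquiv.symm]
    congr 1
    ext x
    rw [map_one SemidirectProduct.inr, U_one_apply]
    rfl
  map_mul' Λ Λ' := by
    rw [← map_mul]
    congr 1
    ext x
    rw [map_mul SemidirectProduct.inr, U_mul_apply]
    rfl

/-- Unfolding of `lorHom`. [folklore] -/
@[simp] theorem lorHom_apply (Λ : restrictedLorentzGroup d) (x : GNSHilbert 𝒲 h𝒲) :
    (lorHom 𝒲 h𝒲 Λ : GNSHilbert 𝒲 h𝒲 →L[ℂ] GNSHilbert 𝒲 h𝒲) x =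
      U 𝒲 h𝒲 (SemidirectProduct.inr Λ) x := rfl

variable (𝒲 h𝒲) in
/-- The representation of the translation group, `a ↦ U(a, 1)`, as a monoid homomorphism into
`B(H)` (strong continuity is proved in `WightmanGNSContinuity`). [folklore] -/
def translHom : Multiplicative (SpaceTime d) →* (GNSHilbert 𝒲 h𝒲 →L[ℂ] GNSHilbert 𝒲 h𝒲) where
  toFun a := (U 𝒲 h𝒲 (SemidirectProduct.inl a) : GNSHilbert 𝒲 h𝒲 →L[ℂ] GNSHilbert 𝒲 h𝒲)
  map_one' := by
    ext x
    change U 𝒲 h𝒲 (SemidirectProduct.inl 1) x = x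
    rw [map_one SemidirectProduct.inl]
    exact U_one_apply x
  map_mul' a b := by
    ext x
    change U 𝒲 h𝒲 (SemidirectProduct.inl (a * b)) x =
      U 𝒲 h𝒲 (SemidirectProduct.inl a) (U 𝒲 h𝒲 (SemidirectProduct.inl b) x)
    rw [map_mul SemidirectProduct.inl, U_mul_apply]

/-- Unfolding of `translHom`. [folklore] -/
@[simp] theorem translHom_apply (a : Multiplicative (SpaceTime d)) (x : GNSHilbert 𝒲 h𝒲) :
    translHom 𝒲 h𝒲 a x = U 𝒲 h𝒲 (SemidirectProduct.inl a) x := rfl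

/-- The translations are unitary operators. [folklore] -/
theorem translHom_mem_unitary (a : Multiplicative (SpaceTime d)) :
    translHom 𝒲 h𝒲 a ∈ unitary (GNSHilbert 𝒲 h𝒲 →L[ℂ] GNSHilbert 𝒲 h𝒲) :=
  (Unitary.linearIsometryEquiv.symm (U 𝒲 h𝒲 (SemidirectProduct.inl a))).2

/-- **The semidirect-product relation** `U(Λ) U(a) U(Λ)⁻¹ = U(Λ a)`. [folklore] -/
theorem lor_transl (Λ : restrictedLorentzGroup d) (a : Multiplicative (SpaceTime d)) :
    (lorHom 𝒲 h𝒲 Λ : GNSHilbert 𝒲 h𝒲 →L[ℂ] GNSHilbert 𝒲 h𝒲) * translHom 𝒲 h𝒲 a *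
        (lorHom 𝒲 h𝒲 Λ⁻¹ : GNSHilbert 𝒲 h𝒲 →L[ℂ] GNSHilbert 𝒲 h𝒲) =
      translHom 𝒲 h𝒲 (lorentzAct d Λ a) := by
  ext x
  change U 𝒲 h𝒲 (SemidirectProduct.inr Λ) (U 𝒲 h𝒲 (SemidirectProduct.inl a)
    (U 𝒲 h𝒲 (SemidirectProduct.inr Λ⁻¹) x)) = U 𝒲 h𝒲 (SemidirectProduct.inl (lorentzAct d Λ a)) x
  rw [← U_mul_apply, ← U_mul_apply, ← SemidirectProduct.inl_aut]

end GNSSpace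

end WightmanFamily

end Literature.Analysis.FunctionSpaces
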